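import Literature.Probability.LatticeModels.RandomClusterFiniteVolumePressure
import HarnessLib

/-!
# LARGE DEVIATIONS OF THE NUMBER OF OPEN EDGES OF THE RANDOM-CLUSTER MODEL, I: THE MEASURES `φ^B_{G,p,q}`, `0 < p < 1`, ARE AN
# EXPONENTIAL FAMILY IN `π = log(p/(1−p))`; MOMENT GENERATING FUNCTION OF `|ω|`, TANGENT BOUNDS, CHERNOFF BOUNDS (any finite graph,
# any wired set, every `q > 0`; Grimmett 2006 §4.5 (4.54)–(4.58), (4.72); Ellis 2006 Thm. II.6.1)

Claimed R42 (8)(c) in the cell INBOX at 2026-08-29T12:35:52Z by fkp-10a gen 360 (NEW CLAIM #3 of the gen), addressed to coordinator fk-4 gen 299 (seated 12:03Z 2026-08-29; R182 / R183 in force; ruling R184 requested); lineage row FO-10a-g360r (self-suggested), package g360-rcld, label RC-A.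
Helper file of the `fk-continuity` build cell (bschramm lane; `--supports stmt-CriticalPhenomena-4575`; fkp-10a gen 360,
package g360-rcld, label RC-A); builds on p205010 (kernel theorem, internal audit signed; external expert review
pending). No definitions, no named facts, no sorries; standard axioms.
UNCONDITIONAL (random-cluster measure `φ^B_{G,p,q}` of ANY finite simple graph `G` with ANY wired vertex set `B`, every `q > 0`,
edge-weights `p, p' ∈ (0,1)`; `|ω|` = number of open edges, `|E| = |E(G)|`, `Z(p) = Z^B_{G,p,q}`).
Scope: finite-volume identities and inequalities for the law of `|ω|` (no infinite-volume statement, no `p_c`, nothing about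
FH / TP_FK); nothing percolation-bearing beyond the finite volume.

Writing `L(p) = log Z^B_{G,p,q} − |E| log(1−p)` (Grimmett's `log Y^B_G(π)` in the chart `π = log(p/(1−p))`, (4.54)–(4.56); a convex
function of `π`, tree: `convexOn_log_rcPartitionFunction_logistic`) and `t = log(p'(1−p)/(p(1−p'))) = π' − π`:

* `ratio_pow_mul_pow_eq` — `(p'/p)^{|ω|}((1−p')/(1−p))^{|E∖ω|} = e^{t|ω|} ((1−p')/(1−p))^{|E|}` (`ω ⊆ E`);
* **`rcExpect_exp_mul_card`** — THE MOMENT GENERATING FUNCTION: `E^B_{G,p,q} e^{t|ω|} = ((1−p)/(1−p'))^{|E|} · Z(p')/Z(p)`, i.e.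
  `log E_p e^{t|ω|} = L(p') − L(p)` (`log_rcExpect_exp_mul_card`): the random-cluster measures at fixed `q` are an exponential family
  in `π`, with cumulant generating function the increment of the convex `L`;
* `mul_rcExpect_card_le_sub` / `sub_le_mul_rcExpect_card` — TANGENT BOUNDS `t E_p|ω| ≤ L(p') − L(p) ≤ t E_{p'}|ω|` (Jensen; the first
  is the tree's `log_rcPartitionFunction_sub_ge` rearranged);
* **`rcExpect_indicator_le_card_le`** / `rcExpect_indicator_card_le_le` — CHERNOFF BOUNDS:
  `φ_p{a ≤ |ω|} ≤ exp(−(ta − (L(p') − L(p))))` for `p ≤ p'`, `φ_p{|ω| ≤ a} ≤ exp(−(ta − (L(p') − L(p))))` for `p' ≤ p`;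
  mean forms `…_mean` (`φ_p{a ≤ |ω|} ≤ exp(−t(a − E_{p'}|ω|))`); measure forms `rcMeasure_real_le_ncard_le` / `…_ncard_le_le`.

The sequel `RandomClusterEdgeDensityLargeDeviations` passes to `ℤ^d` boxes: LD upper bounds with the convex `π`-pressure and the
exponential absence of edge densities above `h¹(p,q)` / below `h⁰(p,q)`.

## References

* G. Grimmett, *The Random-Cluster Model*, Springer (2006), §1.2 eq. (1.2), §4.5 (4.54)–(4.58), (4.72)–(4.73) (the pressure as a
  convex function of `π`, its derivative the edge density). [Grimmett2006]
* R. S. Ellis, *Entropy, Large Deviations, and Statistical Mechanics*, Springer (2006), Thm. II.6.1 (the upper large-deviation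
  bound from the free-energy function), §VII.3. [Ellis2006]
-/

noncomputable section

namespace Summit.CriticalPhenomena.PercolationContinuityZ3.Theorems.FK

namespace RandomClusterLargeDeviations

open Finset Set
open Literature.Probability.LatticeModels Literature.Probability.Percolation

variable {V : Type*} [Fintype V] [DecidableEq V] (G : SimpleGraph V) [DecidableRel G.Adj]

/-! ### The tilt `p ↦ p'` multiplies the weight of `ω` by `e^{t|ω|}` up to a constant -/

omit [Fintype V] [DecidableEq V] [DecidableRel G.Adj] in
/-- For `p, p' ∈ (0,1)`, `(p'/p)·((1−p)/(1−p')) = exp t` with `t = log(p'(1−p)/(p(1−p')))`. [folklore] -/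
theorem exp_log_ratio {p p' : ℝ} (hp : p ∈ Set.Ioo (0 : ℝ) 1) (hp' : p' ∈ Set.Ioo (0 : ℝ) 1) :
    Real.exp (Real.log (p' * (1 - p) / (p * (1 - p')))) = p' / p * ((1 - p) / (1 - p')) := by
  rw [Real.exp_log (by have := hp.1; have := hp.2; have := hp'.1; have := hp'.2; positivity)]
  field_simp

/-- **`(p'/p)^{|ω|}((1−p')/(1−p))^{|E∖ω|} = e^{t|ω|}((1−p')/(1−p))^{|E|}`** for `ω ⊆ E(G)`. [cite: Grimmett2006, §1.2 eq. (1.2), §4.5 (4.54)] -/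
theorem ratio_pow_mul_pow_eq {p p' : ℝ} (hp : p ∈ Set.Ioo (0 : ℝ) 1) (hp' : p' ∈ Set.Ioo (0 : ℝ) 1) {ω : Finset (Sym2 V)}
    (hω : ω ⊆ G.edgeFinset) :
    (p' / p) ^ #ω * ((1 - p') / (1 - p)) ^ #(G.edgeFinset \ ω) =
      Real.exp (Real.log (p' * (1 - p) / (p * (1 - p'))) * #ω) * ((1 - p') / (1 - p)) ^ #G.edgeFinset := by
  have h1p : 0 < 1 - p := sub_pos.2 hp.2
  have h1p' : 0 < 1 - p' := sub_pos.2 hp'.2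
  have hle : #ω ≤ #G.edgeFinset := Finset.card_le_card hω
  have hc0 : (1 - p') / (1 - p) ≠ 0 := (div_pos h1p' h1p).ne'
  rw [Real.exp_mul, exp_log_ratio hp hp', Real.rpow_natCast, Finset.card_sdiff_of_subset hω, pow_sub₀ _ hc0 hle,
    mul_pow, show (1 - p) / (1 - p') = ((1 - p') / (1 - p))⁻¹ by rw [inv_div], inv_pow]
  have hck : ((1 - p') / (1 - p)) ^ #ω ≠ 0 := pow_ne_zero _ hc0
  field_simp

/-! ### The moment generating function of `|ω|` -/

/-- **THE MOMENT GENERATING FUNCTION OF THE NUMBER OF OPEN EDGES**: for `p, p' ∈ (0,1)`, `q > 0`, any wired set `B`, with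
`t = log(p'(1−p)/(p(1−p')))`: `E^B_{G,p,q} e^{t|ω|} = ((1−p)/(1−p'))^{|E|} · Z^B_{G,p',q}/Z^B_{G,p,q}` — the random-cluster measures
at fixed `q` form an exponential family in `π = log(p/(1−p))` with natural statistic `|ω|`.
[cite: Grimmett2006, §4.5 (4.54)–(4.56) and (4.72); Ellis2006, §VII.3] -/
theorem rcExpect_exp_mul_card {p p' q : ℝ} (hp : p ∈ Set.Ioo (0 : ℝ) 1) (hp' : p' ∈ Set.Ioo (0 : ℝ) 1) (hq : 0 < q)
    (B : Set V) :
    rcExpect G p q B (fun ω => Real.exp (Real.log (p' * (1 - p) / (p * (1 - p'))) * #ω)) =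
      ((1 - p) / (1 - p')) ^ #G.edgeFinset * (rcPartitionFunction G p' q B / rcPartitionFunction G p q B) := by
  have hpI : p ∈ Set.Icc (0 : ℝ) 1 := ⟨hp.1.le, hp.2.le⟩
  have h1p : 0 < 1 - p := sub_pos.2 hp.2
  have h1p' : 0 < 1 - p' := sub_pos.2 hp'.2
  have hZ := rcPartitionFunction_pos G hpI hq B
  -- `Z(p')/Z(p) = E_p[(p'/p)^{|ω|}((1−p')/(1−p))^{|E∖ω|}]`
  have hquot : rcPartitionFunction G p' q B / rcPartitionFunction G p q B =
      rcExpect G p q B (fun ω => (p' / p) ^ #ω * ((1 - p') / (1 - p)) ^ #(G.edgeFinset \ ω)) := by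
    rw [rcExpect, rcPartitionFunction, Finset.sum_div]
    refine Finset.sum_congr rfl fun ω _ => ?_
    rw [rcWeight_eq_mul_ratio G hp p' q B ω, mul_div_right_comm]
  have h2 : rcExpect G p q B (fun ω => (p' / p) ^ #ω * ((1 - p') / (1 - p)) ^ #(G.edgeFinset \ ω)) =
      ((1 - p') / (1 - p)) ^ #G.edgeFinset *
        rcExpect G p q B (fun ω => Real.exp (Real.log (p' * (1 - p) / (p * (1 - p'))) * #ω)) := by
    rw [← rcExpect_const_mul]
    exact rcExpect_congr G p q B fun ω hω => by rw [ratio_pow_mul_pow_eq G hp hp' hω, mul_comm]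
  rw [hquot, h2, ← mul_assoc, ← mul_pow, div_mul_div_comm, mul_comm (1 - p) (1 - p'),
    div_self (by positivity), one_pow, one_mul]

/-- **THE CUMULANT GENERATING FUNCTION IS THE INCREMENT OF `L(p) = log Z(p) − |E| log(1−p)`**:
`log E_p e^{t|ω|} = (log Z(p') − |E| log(1−p')) − (log Z(p) − |E| log(1−p))` — Grimmett's `log Y(π') − log Y(π)`.
[cite: Grimmett2006, §4.5 (4.54)–(4.56), (4.72); Ellis2006, (2.28)] -/
theorem log_rcExpect_exp_mul_card {p p' q : ℝ} (hp : p ∈ Set.Ioo (0 : ℝ) 1) (hp' : p' ∈ Set.Ioo (0 : ℝ) 1) (hq : 0 < q)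
    (B : Set V) :
    Real.log (rcExpect G p q B (fun ω => Real.exp (Real.log (p' * (1 - p) / (p * (1 - p'))) * #ω))) =
      (Real.log (rcPartitionFunction G p' q B) - #G.edgeFinset * Real.log (1 - p')) -
        (Real.log (rcPartitionFunction G p q B) - #G.edgeFinset * Real.log (1 - p)) := by
  have h1p : 0 < 1 - p := sub_pos.2 hp.2
  have h1p' : 0 < 1 - p' := sub_pos.2 hp'.2
  have hZ := rcPartitionFunction_pos G ⟨hp.1.le, hp.2.le⟩ hq B
  have hZ' := rcPartitionFunction_pos G ⟨hp'.1.le, hp'.2.le⟩ hq B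
  rw [rcExpect_exp_mul_card G hp hp' hq B, Real.log_mul (pow_pos (div_pos h1p h1p') _).ne' (div_pos hZ' hZ).ne',
    Real.log_pow, Real.log_div h1p.ne' h1p'.ne', Real.log_div hZ'.ne' hZ.ne']
  ring

/-! ### Tangent bounds: `t E_p|ω| ≤ L(p') − L(p) ≤ t E_{p'}|ω|` -/

/-- **LOWER TANGENT BOUND `t E_p|ω| ≤ L(p') − L(p)`** (the convex `L` lies above its tangent at `π`; Jensen — the tree's
`log_rcPartitionFunction_sub_ge` rearranged). [cite: Grimmett2006, proof of Thm. (4.58), (4.72)–(4.73)] -/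
theorem mul_rcExpect_card_le_sub {p p' q : ℝ} (hp : p ∈ Set.Ioo (0 : ℝ) 1) (hp' : p' ∈ Set.Ioo (0 : ℝ) 1) (hq : 0 < q)
    (B : Set V) :
    Real.log (p' * (1 - p) / (p * (1 - p'))) * rcExpect G p q B (fun ω => (#ω : ℝ)) ≤
      (Real.log (rcPartitionFunction G p' q B) - #G.edgeFinset * Real.log (1 - p')) -
        (Real.log (rcPartitionFunction G p q B) - #G.edgeFinset * Real.log (1 - p)) := by
  have h := log_rcPartitionFunction_sub_ge G hp hp' hq B
  have h1p : 0 < 1 - p := sub_pos.2 hp.2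
  have h1p' : 0 < 1 - p' := sub_pos.2 hp'.2
  have e1 : Real.log (p' * (1 - p) / (p * (1 - p'))) =
      Real.log p' + Real.log (1 - p) - (Real.log p + Real.log (1 - p')) := by
    rw [Real.log_div (mul_pos hp'.1 h1p).ne' (mul_pos hp.1 h1p').ne', Real.log_mul hp'.1.ne' h1p.ne',
      Real.log_mul hp.1.ne' h1p'.ne']
  rw [Real.log_div hp'.1.ne' hp.1.ne', Real.log_div h1p'.ne' h1p.ne'] at h
  rw [e1]
  linear_combination h

/-- **UPPER TANGENT BOUND `L(p') − L(p) ≤ t E_{p'}|ω|`** (the tangent at `π'`). [cite: Grimmett2006, proof of Thm. (4.58), (4.72)–(4.73)] -/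
theorem sub_le_mul_rcExpect_card {p p' q : ℝ} (hp : p ∈ Set.Ioo (0 : ℝ) 1) (hp' : p' ∈ Set.Ioo (0 : ℝ) 1) (hq : 0 < q)
    (B : Set V) :
    (Real.log (rcPartitionFunction G p' q B) - #G.edgeFinset * Real.log (1 - p')) -
        (Real.log (rcPartitionFunction G p q B) - #G.edgeFinset * Real.log (1 - p)) ≤
      Real.log (p' * (1 - p) / (p * (1 - p'))) * rcExpect G p' q B (fun ω => (#ω : ℝ)) := by
  have h := mul_rcExpect_card_le_sub G hp' hp hq B
  have h1p : 0 < 1 - p := sub_pos.2 hp.2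
  have h1p' : 0 < 1 - p' := sub_pos.2 hp'.2
  have hlog : Real.log (p * (1 - p') / (p' * (1 - p))) = -Real.log (p' * (1 - p) / (p * (1 - p'))) := by
    rw [← Real.log_inv, inv_div]
  rw [hlog] at h
  linarith

/-! ### Chernoff bounds -/

/-- **CHERNOFF UPPER-TAIL BOUND**: for `p ≤ p'` in `(0,1)` (so `t = log(p'(1−p)/(p(1−p'))) ≥ 0`), `q > 0` and every real `a`,
`φ^B_{G,p,q}{a ≤ |ω|} ≤ exp(−(ta − (L(p') − L(p))))`. [cite: Ellis2006, Thm. II.6.1 (b) (proof); Grimmett2006, §4.5 (4.72)] -/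
theorem rcExpect_indicator_le_card_le {p p' q : ℝ} (hp : p ∈ Set.Ioo (0 : ℝ) 1) (hp' : p' ∈ Set.Ioo (0 : ℝ) 1) (hpp' : p ≤ p')
    (hq : 0 < q) (B : Set V) (a : ℝ) :
    rcExpect G p q B (fun ω => if a ≤ (#ω : ℝ) then 1 else 0) ≤
      Real.exp (-(Real.log (p' * (1 - p) / (p * (1 - p'))) * a -
        ((Real.log (rcPartitionFunction G p' q B) - #G.edgeFinset * Real.log (1 - p')) -
          (Real.log (rcPartitionFunction G p q B) - #G.edgeFinset * Real.log (1 - p))))) := by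
  have hpI : p ∈ Set.Icc (0 : ℝ) 1 := ⟨hp.1.le, hp.2.le⟩
  set t : ℝ := Real.log (p' * (1 - p) / (p * (1 - p'))) with ht
  have ht0 : 0 ≤ t := by
    rw [ht]
    refine Real.log_nonneg ?_
    rw [le_div_iff₀ (mul_pos hp.1 (sub_pos.2 hp'.2))]
    nlinarith [hp.1, hp'.2]
  -- Markov: `1{a ≤ |ω|} ≤ e^{t(|ω| − a)}`
  have hmono : rcExpect G p q B (fun ω => if a ≤ (#ω : ℝ) then 1 else 0) ≤
      rcExpect G p q B (fun ω => Real.exp (-(t * a)) * Real.exp (t * #ω)) := by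
    refine rcExpect_mono G hpI hq B fun ω _ => ?_
    split_ifs with h
    · rw [← Real.exp_add]
      have : 0 ≤ -(t * a) + t * #ω := by nlinarith
      linarith [Real.add_one_le_exp (-(t * a) + t * #ω)]
    · positivity
  have hpos : 0 < rcExpect G p q B (fun ω => Real.exp (t * #ω)) := by
    rw [ht, rcExpect_exp_mul_card G hp hp' hq B]
    exact mul_pos (pow_pos (div_pos (sub_pos.2 hp.2) (sub_pos.2 hp'.2)) _)
      (div_pos (rcPartitionFunction_pos G ⟨hp'.1.le, hp'.2.le⟩ hq B) (rcPartitionFunction_pos G hpI hq B))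
  calc rcExpect G p q B (fun ω => if a ≤ (#ω : ℝ) then 1 else 0)
      ≤ Real.exp (-(t * a)) * rcExpect G p q B (fun ω => Real.exp (t * #ω)) := by rwa [← rcExpect_const_mul]
    _ = Real.exp (-(t * a - ((Real.log (rcPartitionFunction G p' q B) - #G.edgeFinset * Real.log (1 - p')) -
          (Real.log (rcPartitionFunction G p q B) - #G.edgeFinset * Real.log (1 - p))))) := by
        rw [← Real.exp_log hpos, ← Real.exp_add, ht, log_rcExpect_exp_mul_card G hp hp' hq B]
        congr 1
        ring

/-- **CHERNOFF LOWER-TAIL BOUND**: for `p' ≤ p` in `(0,1)` (so `t ≤ 0`), `q > 0`, every real `a`,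
`φ^B_{G,p,q}{|ω| ≤ a} ≤ exp(−(ta − (L(p') − L(p))))`. [cite: Ellis2006, Thm. II.6.1 (b) (proof); Grimmett2006, §4.5 (4.72)] -/
theorem rcExpect_indicator_card_le_le {p p' q : ℝ} (hp : p ∈ Set.Ioo (0 : ℝ) 1) (hp' : p' ∈ Set.Ioo (0 : ℝ) 1) (hpp' : p' ≤ p)
    (hq : 0 < q) (B : Set V) (a : ℝ) :
    rcExpect G p q B (fun ω => if (#ω : ℝ) ≤ a then 1 else 0) ≤
      Real.exp (-(Real.log (p' * (1 - p) / (p * (1 - p'))) * a -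
        ((Real.log (rcPartitionFunction G p' q B) - #G.edgeFinset * Real.log (1 - p')) -
          (Real.log (rcPartitionFunction G p q B) - #G.edgeFinset * Real.log (1 - p))))) := by
  have hpI : p ∈ Set.Icc (0 : ℝ) 1 := ⟨hp.1.le, hp.2.le⟩
  set t : ℝ := Real.log (p' * (1 - p) / (p * (1 - p'))) with ht
  have ht0 : t ≤ 0 := by
    rw [ht]
    refine Real.log_nonpos (by have := hp.1; have := hp'.1; have := sub_pos.2 hp.2; have := sub_pos.2 hp'.2; positivity) ?_
    rw [div_le_one (mul_pos hp.1 (sub_pos.2 hp'.2))]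
    nlinarith [hp'.1, hp.2]
  have hmono : rcExpect G p q B (fun ω => if (#ω : ℝ) ≤ a then 1 else 0) ≤
      rcExpect G p q B (fun ω => Real.exp (-(t * a)) * Real.exp (t * #ω)) := by
    refine rcExpect_mono G hpI hq B fun ω _ => ?_
    split_ifs with h
    · rw [← Real.exp_add]
      have : 0 ≤ -(t * a) + t * #ω := by nlinarith
      linarith [Real.add_one_le_exp (-(t * a) + t * #ω)]
    · positivity
  have hpos : 0 < rcExpect G p q B (fun ω => Real.exp (t * #ω)) := by
    rw [ht, rcExpect_exp_mul_card G hp hp' hq B]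
    exact mul_pos (pow_pos (div_pos (sub_pos.2 hp.2) (sub_pos.2 hp'.2)) _)
      (div_pos (rcPartitionFunction_pos G ⟨hp'.1.le, hp'.2.le⟩ hq B) (rcPartitionFunction_pos G hpI hq B))
  calc rcExpect G p q B (fun ω => if (#ω : ℝ) ≤ a then 1 else 0)
      ≤ Real.exp (-(t * a)) * rcExpect G p q B (fun ω => Real.exp (t * #ω)) := by rwa [← rcExpect_const_mul]
    _ = Real.exp (-(t * a - ((Real.log (rcPartitionFunction G p' q B) - #G.edgeFinset * Real.log (1 - p')) -
          (Real.log (rcPartitionFunction G p q B) - #G.edgeFinset * Real.log (1 - p))))) := by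
        rw [← Real.exp_log hpos, ← Real.exp_add, ht, log_rcExpect_exp_mul_card G hp hp' hq B]
        congr 1
        ring

/-- **CHERNOFF UPPER-TAIL BOUND, MEAN FORM**: for `p ≤ p'`, `φ_p{a ≤ |ω|} ≤ exp(−t(a − E_{p'}|ω|))` (upper tangent bound).
[cite: Ellis2006, Thm. II.6.1 (b); Grimmett2006, (4.72)–(4.73)] -/
theorem rcExpect_indicator_le_card_le_mean {p p' q : ℝ} (hp : p ∈ Set.Ioo (0 : ℝ) 1) (hp' : p' ∈ Set.Ioo (0 : ℝ) 1)
    (hpp' : p ≤ p') (hq : 0 < q) (B : Set V) (a : ℝ) :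
    rcExpect G p q B (fun ω => if a ≤ (#ω : ℝ) then 1 else 0) ≤
      Real.exp (-(Real.log (p' * (1 - p) / (p * (1 - p'))) * (a - rcExpect G p' q B (fun ω => (#ω : ℝ))))) := by
  refine (rcExpect_indicator_le_card_le G hp hp' hpp' hq B a).trans ?_
  rw [Real.exp_le_exp]
  have := sub_le_mul_rcExpect_card G hp hp' hq B
  nlinarith

/-- **CHERNOFF LOWER-TAIL BOUND, MEAN FORM**: for `p' ≤ p`, `φ_p{|ω| ≤ a} ≤ exp(−t(a − E_{p'}|ω|))` (`t ≤ 0`).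
[cite: Ellis2006, Thm. II.6.1 (b); Grimmett2006, (4.72)–(4.73)] -/
theorem rcExpect_indicator_card_le_le_mean {p p' q : ℝ} (hp : p ∈ Set.Ioo (0 : ℝ) 1) (hp' : p' ∈ Set.Ioo (0 : ℝ) 1)
    (hpp' : p' ≤ p) (hq : 0 < q) (B : Set V) (a : ℝ) :
    rcExpect G p q B (fun ω => if (#ω : ℝ) ≤ a then 1 else 0) ≤
      Real.exp (-(Real.log (p' * (1 - p) / (p * (1 - p'))) * (a - rcExpect G p' q B (fun ω => (#ω : ℝ))))) := by
  refine (rcExpect_indicator_card_le_le G hp hp' hpp' hq B a).trans ?_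
  rw [Real.exp_le_exp]
  have := sub_le_mul_rcExpect_card G hp hp' hq B
  nlinarith

/-! ### Measure forms -/

/-- The event `{a ≤ |ω|}` under `φ^B_{G,p,q}` as the expectation of an indicator. [cite: Grimmett2006, §1.2 eq. (1.2)] -/
theorem rcMeasure_real_ncard_ge_eq {p q : ℝ} (hp : p ∈ Set.Icc (0 : ℝ) 1) (hq : 0 < q) (B : Set V) (a : ℝ) :
    (rcMeasure G p q B).real {η : BondConfig V | a ≤ (η.ncard : ℝ)} =
      rcExpect G p q B (fun ω => if a ≤ (#ω : ℝ) then 1 else 0) := by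
  classical
  rw [rcMeasure_real_eq_rcExpect G hp hq B]
  refine rcExpect_congr G p q B fun ω _ => ?_
  simp only [Set.mem_setOf_eq, Set.ncard_coe_finset]

/-- The event `{|ω| ≤ a}` under `φ^B_{G,p,q}` as the expectation of an indicator. [cite: Grimmett2006, §1.2 eq. (1.2)] -/
theorem rcMeasure_real_ncard_le_eq {p q : ℝ} (hp : p ∈ Set.Icc (0 : ℝ) 1) (hq : 0 < q) (B : Set V) (a : ℝ) :
    (rcMeasure G p q B).real {η : BondConfig V | (η.ncard : ℝ) ≤ a} =
      rcExpect G p q B (fun ω => if (#ω : ℝ) ≤ a then 1 else 0) := by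
  classical
  rw [rcMeasure_real_eq_rcExpect G hp hq B]
  refine rcExpect_congr G p q B fun ω _ => ?_
  simp only [Set.mem_setOf_eq, Set.ncard_coe_finset]

/-- **CHERNOFF UPPER TAIL, measure form**: `φ^B_{G,p,q}{a ≤ |ω|} ≤ exp(−(ta − (L(p') − L(p))))` for `p ≤ p'` in `(0,1)`.
[cite: Ellis2006, Thm. II.6.1 (b); Grimmett2006, §4.5 (4.72)] -/
theorem rcMeasure_real_le_ncard_le {p p' q : ℝ} (hp : p ∈ Set.Ioo (0 : ℝ) 1) (hp' : p' ∈ Set.Ioo (0 : ℝ) 1) (hpp' : p ≤ p')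
    (hq : 0 < q) (B : Set V) (a : ℝ) :
    (rcMeasure G p q B).real {η : BondConfig V | a ≤ (η.ncard : ℝ)} ≤
      Real.exp (-(Real.log (p' * (1 - p) / (p * (1 - p'))) * a -
        ((Real.log (rcPartitionFunction G p' q B) - #G.edgeFinset * Real.log (1 - p')) -
          (Real.log (rcPartitionFunction G p q B) - #G.edgeFinset * Real.log (1 - p))))) := by
  rw [rcMeasure_real_ncard_ge_eq G ⟨hp.1.le, hp.2.le⟩ hq B a]
  exact rcExpect_indicator_le_card_le G hp hp' hpp' hq B a

/-- **CHERNOFF LOWER TAIL, measure form**: `φ^B_{G,p,q}{|ω| ≤ a} ≤ exp(−(ta − (L(p') − L(p))))` for `p' ≤ p` in `(0,1)`.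
[cite: Ellis2006, Thm. II.6.1 (b); Grimmett2006, §4.5 (4.72)] -/
theorem rcMeasure_real_ncard_le_le {p p' q : ℝ} (hp : p ∈ Set.Ioo (0 : ℝ) 1) (hp' : p' ∈ Set.Ioo (0 : ℝ) 1) (hpp' : p' ≤ p)
    (hq : 0 < q) (B : Set V) (a : ℝ) :
    (rcMeasure G p q B).real {η : BondConfig V | (η.ncard : ℝ) ≤ a} ≤
      Real.exp (-(Real.log (p' * (1 - p) / (p * (1 - p'))) * a -
        ((Real.log (rcPartitionFunction G p' q B) - #G.edgeFinset * Real.log (1 - p')) -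
          (Real.log (rcPartitionFunction G p q B) - #G.edgeFinset * Real.log (1 - p))))) := by
  rw [rcMeasure_real_ncard_le_eq G ⟨hp.1.le, hp.2.le⟩ hq B a]
  exact rcExpect_indicator_card_le_le G hp hp' hpp' hq B a

end RandomClusterLargeDeviations

end Summit.CriticalPhenomena.PercolationContinuityZ3.Theorems.FK
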